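import Summits.AtomisticToContinuum.HydrodynamicLimit.Theorems.JParityClosureLocalSecondLawLedgerJumpB
import Summits.AtomisticToContinuum.HydrodynamicLimit.Theorems.JParityClosureLocalSecondLawLedgerOrbit

/-!
# Entropy ledger for `JParityClosure.LocalSecondLaw` — the pathwise ledger inequality (stub L)
(stmt-AtomisticToContinuum-13081, line `exact-entropy-ledger-three-passivities`, final layer of stub L)

`stub_ledger`: on the regular event of a good orbit, for a smooth non-negative test function vanishing from
some `τ' < τ` on, `T₁ + T₂ + T₃ ≤ entropyFunctional + bdry`.  Assembly of the layers: the weak balance law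
along the orbit for the observable `∫ Ĥ(U_r) φ(s, ·)` (layer 13) reads
`-bdry = [entropyFunctional - T₁ - T₂smooth - T₃kin] + Σ_{collisions in (0,τ]} jumps`, and each jump is bounded
by the collision integrands of BOTH ordered contact pairs with weight `1/2` (layers 14–15), so that the total
jump is at most `-(T₂coll + T₃coll)`.

References: R. J. Hardy, J. Chem. Phys. 76 (1982) 622; J. H. Irving, J. G. Kirkwood, J. Chem. Phys. 18 (1950)
817; H. Spohn, *Large Scale Dynamics of Interacting Particles* (1991), Part I §3.
-/

noncomputable section

namespace Summit.AtomisticToContinuum.HydrodynamicLimit.Theorems.LocalSecondLawLedger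

open scoped BigOperators Topology ENNReal InnerProductSpace NNReal
open Filter Set MeasureTheory Function
open Literature.MathematicalPhysics.KineticTheory
open Literature.Analysis.FluidPDE
open Literature.Analysis.FunctionSpaces
open Summit.AtomisticToContinuum.HydrodynamicLimit.Theorems.LocalSecondLawNegative

namespace L

variable {N : ℕ}

section Assembly

variable {σ r c η₁ η₀ τ : ℝ} {F : ℝ → ℝ} (hE : EosBand η₀ F) (hη : 0 < η₁) (hη₁ : η₁ < η₀) (hσ : 0 < σ)
  (hr : 0 < r) (hc : 0 < c) (hτ : 0 < τ) {φ : ℝ → T3 → ℝ} (hφ : Torus.IsSmoothSpaceTimeOn Set.univ φ)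
  (hφ0 : ∀ s x, 0 ≤ φ s x) (hsupp : ∃ τ' : ℝ, τ' < τ ∧ ∀ s, τ' ≤ s → ∀ x, φ s x = 0)
  (Φ : Flow σ N) {z : Phase N} (hR : Regular σ r τ c η₁ Φ z)

/-- The collision integrand of `T₂coll` (times `2`) for an ordered pair. -/
def I₂ (σ r : ℝ) (φ : ℝ → T3 → ℝ) (Φ : Flow σ N) (z : Phase N) (t : ℝ) (p q : Fin (N + 1)) : ℝ :=
  ∫ x, φ t x / thetaC r (Φ.flow t z) x * bondC r (Φ.flow t z) p q x * impulse (hsDiameter σ N) (Φ.flow t z) p q *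
    ∑ k, ∑ l, nrm (hsDiameter σ N) (Φ.flow t z) p q k * nrm (hsDiameter σ N) (Φ.flow t z) p q l *
      pD k (fun y => uC r (Φ.flow t z) y l) x

/-- The collision integrand of `T₃coll` (times `2`) for an ordered pair. -/
def I₃ (σ r : ℝ) (φ : ℝ → T3 → ℝ) (Φ : Flow σ N) (z : Phase N) (t : ℝ) (p q : Fin (N + 1)) : ℝ :=
  ∫ x, (∑ k, pD k (fun y => φ t y / thetaC r (Φ.flow t z) y) x * nrm (hsDiameter σ N) (Φ.flow t z) p q k) *
    bondC r (Φ.flow t z) p q x * (impulse (hsDiameter σ N) (Φ.flow t z) p q / 2) *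
    ⟪(vin (Φ.flow t z) p q).1 + (vin (Φ.flow t z) p q).2 - (2 : ℝ) • uC r (Φ.flow t z) x,
      nrm (hsDiameter σ N) (Φ.flow t z) p q⟫_ℝ

include hE hη₁ hσ hr hc hφ hφ0 hR in
/-- **The jump at a collision is bounded by the contact sum of the collision integrands** (both ordered pairs,
weight `1/2`). [folklore] -/
theorem collisionJump_obs_le_contactSum {t : ℝ}
    (ht : t ∈ collisionTimes (Torus.geometry (Fin 3)) (hsDiameter σ N) (fun s => Φ.flow s z) ∩ Set.Ioc 0 τ) :
    collisionJump (obs σ c η₀ η₁ r φ t) (fun s => Φ.flow s z) t ≤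
      hsDiameter σ N / (N + 1 : ℝ) * ∑ p : Fin (N + 1), ∑ q : Fin (N + 1),
        (if p ≠ q ∧ ‖(Torus.geometry (Fin 3)).sepVec (Φ.flow t z p).1 (Φ.flow t z q).1‖ = hsDiameter σ N then
          (1 / 2 : ℝ) * I₂ σ r φ Φ z t p q - (1 / 2 : ℝ) * I₃ σ r φ Φ z t p q else 0) := by
  obtain ⟨i, j, hij, hcs⟩ := mem_collisionTimes.1 ht.1
  have hct : ‖(Torus.geometry (Fin 3)).sepVec (Φ.flow t z i).1 (Φ.flow t z j).1‖ = hsDiameter σ N := (mem_contactSet.1 hcs).2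
  have hcs' := mem_contactSet_symm_torus hcs
  have hct' : ‖(Torus.geometry (Fin 3)).sepVec (Φ.flow t z j).1 (Φ.flow t z i).1‖ = hsDiameter σ N := (mem_contactSet.1 hcs').2
  have Bij := collisionJump_obs_le_pair hE hη₁ hσ hr hc hφ hφ0 Φ hR ht.2 hij hct
  have Bji := collisionJump_obs_le_pair hE hη₁ hσ hr hc hφ hφ0 Φ hR ht.2 hij.symm hct'
  have htraj := Φ.isTrajectory z hR.1
  have hsum : (∑ p : Fin (N + 1), ∑ q : Fin (N + 1),
      (if p ≠ q ∧ ‖(Torus.geometry (Fin 3)).sepVec (Φ.flow t z p).1 (Φ.flow t z q).1‖ = hsDiameter σ N then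
        (1 / 2 : ℝ) * I₂ σ r φ Φ z t p q - (1 / 2 : ℝ) * I₃ σ r φ Φ z t p q else 0)) =
      ((1 / 2 : ℝ) * I₂ σ r φ Φ z t i j - (1 / 2 : ℝ) * I₃ σ r φ Φ z t i j)
        + ((1 / 2 : ℝ) * I₂ σ r φ Φ z t j i - (1 / 2 : ℝ) * I₃ σ r φ Φ z t j i) := by
    rw [← Fintype.sum_prod_type', Fintype.sum_eq_add (i, j) (j, i)]
    · rw [if_pos ⟨hij, hct⟩, if_pos ⟨hij.symm, hct'⟩]
    · exact fun hp => hij (Prod.mk.inj hp).1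
    · rintro ⟨p, q⟩ ⟨hp₁, hp₂⟩
      rw [if_neg]
      rintro ⟨hpq, hnorm⟩
      have hc' : Φ.flow t z ∈ contactSet (Torus.geometry (Fin 3)) (N + 1) (hsDiameter σ N) p q :=
        mem_contactSet.2 ⟨htraj.mem t, hnorm⟩
      rcases collisionPair_eq_or_eq_of_mem_contactSet htraj hij hcs hpq hc' with ⟨rfl, rfl⟩ | ⟨rfl, rfl⟩
      · exact hp₁ rfl
      · exact hp₂ rfl
  rw [hsum]
  have e : hsDiameter σ N / (N + 1 : ℝ) *
      (((1 / 2 : ℝ) * I₂ σ r φ Φ z t i j - (1 / 2 : ℝ) * I₃ σ r φ Φ z t i j)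
        + ((1 / 2 : ℝ) * I₂ σ r φ Φ z t j i - (1 / 2 : ℝ) * I₃ σ r φ Φ z t j i)) =
      (hsDiameter σ N / (N + 1 : ℝ) * (I₂ σ r φ Φ z t i j - I₃ σ r φ Φ z t i j)
        + hsDiameter σ N / (N + 1 : ℝ) * (I₂ σ r φ Φ z t j i - I₃ σ r φ Φ z t j i)) / 2 := by ring
  rw [e]
  have B1 : collisionJump (obs σ c η₀ η₁ r φ t) (fun s => Φ.flow s z) t ≤
      hsDiameter σ N / (N + 1 : ℝ) * (I₂ σ r φ Φ z t i j - I₃ σ r φ Φ z t i j) := Bij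
  have B2 : collisionJump (obs σ c η₀ η₁ r φ t) (fun s => Φ.flow s z) t ≤
      hsDiameter σ N / (N + 1 : ℝ) * (I₂ σ r φ Φ z t j i - I₃ σ r φ Φ z t j i) := Bji
  linarith

include hE hη₁ hσ hr hc hφ hφ0 hR in
/-- **The total entropy jump on `(0, τ]` is at most `-(T₂coll + T₃coll)`.** [folklore] -/
theorem finsum_collisionJump_le :
    ∑ᶠ t ∈ collisionTimes (Torus.geometry (Fin 3)) (hsDiameter σ N) (fun s => Φ.flow s z) ∩ Set.Ioc 0 τ,
        collisionJump (obs σ c η₀ η₁ r φ t) (fun s => Φ.flow s z) t ≤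
      -T₂coll σ r τ φ Φ z - T₃coll σ r τ φ Φ z := by
  have hS := finite_collisionTimes_Ioc Φ hR.1 τ
  have hT2 : T₂coll σ r τ φ Φ z = -(hsDiameter σ N / (N + 1 : ℝ) *
      ∑ᶠ (s : ℝ) (_ : s ∈ collisionTimes (Torus.geometry (Fin 3)) (hsDiameter σ N) (fun t => Φ.flow t z) ∩ Set.Ioc 0 τ),
        ∑ p : Fin (N + 1), ∑ q : Fin (N + 1),
          (if p ≠ q ∧ ‖(Torus.geometry (Fin 3)).sepVec (Φ.flow s z p).1 (Φ.flow s z q).1‖ = hsDiameter σ N then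
            (1 / 2 : ℝ) * I₂ σ r φ Φ z s p q else 0)) := rfl
  have hT3 : T₃coll σ r τ φ Φ z = hsDiameter σ N / (N + 1 : ℝ) *
      ∑ᶠ (s : ℝ) (_ : s ∈ collisionTimes (Torus.geometry (Fin 3)) (hsDiameter σ N) (fun t => Φ.flow t z) ∩ Set.Ioc 0 τ),
        ∑ p : Fin (N + 1), ∑ q : Fin (N + 1),
          (if p ≠ q ∧ ‖(Torus.geometry (Fin 3)).sepVec (Φ.flow s z p).1 (Φ.flow s z q).1‖ = hsDiameter σ N then
            (1 / 2 : ℝ) * I₃ σ r φ Φ z s p q else 0) := rfl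
  rw [hT2, hT3, neg_neg, ← mul_sub, finsum_mem_eq_finite_toFinset_sum _ hS, finsum_mem_eq_finite_toFinset_sum _ hS,
    finsum_mem_eq_finite_toFinset_sum _ hS,
    ← Finset.sum_sub_distrib, Finset.mul_sum]
  refine Finset.sum_le_sum fun t ht => ?_
  have ht' : t ∈ collisionTimes (Torus.geometry (Fin 3)) (hsDiameter σ N) (fun s => Φ.flow s z) ∩ Set.Ioc 0 τ :=
    hS.mem_toFinset.1 ht
  refine (collisionJump_obs_le_contactSum hE hη₁ hσ hr hc hφ hφ0 Φ hR ht').trans (le_of_eq ?_)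
  congr 1
  rw [← Finset.sum_sub_distrib]
  refine Finset.sum_congr rfl fun p _ => ?_
  rw [← Finset.sum_sub_distrib]
  refine Finset.sum_congr rfl fun q _ => ?_
  split_ifs <;> ring

include hE hη hη₁ hσ hr hc hτ hφ hφ0 hsupp hR in
/-- **The pathwise entropy ledger on the regular event.** [folklore] -/
theorem ledger_of_regular :
    T₁ σ r τ φ Φ z + T₂ σ r τ φ Φ z + T₃ σ r τ φ Φ z ≤ entropyFunctional σ r τ φ Φ z + bdry σ r (φ 0) Φ z := by
  have hbal := balance_orbit hE hη hη₁ hσ hr hc hτ hφ hsupp Φ hR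
  rw [integral_obsD_orbit hE hη hη₁ hσ hr hc hφ Φ hR] at hbal
  have hJ := finsum_collisionJump_le hE hη₁ hσ hr hc hφ hφ0 Φ hR
  rw [T₂_eq, T₃_eq]
  linarith

end Assembly

end L

open L in
/-- **L · the pathwise entropy ledger** (registered stub `stub_ledger` of the line
`exact-entropy-ledger-three-passivities`).  Given the EOS band, a cap `η₁ < η₀`, a floor `c > 0`, `σ, r, τ > 0`
and a smooth `φ ≥ 0` vanishing from some `τ' < τ` on: for EVERY `N`, flow `Φ` and phase point `z` in the
regular event, `T₁ z + T₂ z + T₃ z ≤ entropyFunctional σ r τ φ Φ z + ∫ H(ρ_r(Φ₀z), θ_r(Φ₀z)) φ(0)`.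
Proof: layers 1–15 of this directory (same-kernel identity, Gibbs relation, Rademacher + integration by parts on
the torus for the Lipschitz cone fields, the weak balance law along the good orbit for the smooth modification
`Ĥ` of the entropy density, convexity of `H` in `(m, e)` at fixed `ρ`, Hardy's bond); the case `η₁ ≤ 0` is
vacuous (the regular event is empty). [folklore] -/
theorem stub_ledger :
  ∀ (η₀ : ℝ) (F : ℝ → ℝ), EosBand η₀ F →
  ∀ (η₁ c σ r τ : ℝ), η₁ < η₀ → 0 < c → 0 < σ → 0 < r → 0 < τ →
  ∀ φ : ℝ → T3 → ℝ, Literature.Analysis.FunctionSpaces.Torus.IsSmoothSpaceTimeOn Set.univ φ →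
    (∀ s x, 0 ≤ φ s x) → (∃ τ' : ℝ, τ' < τ ∧ ∀ s, τ' ≤ s → ∀ x, φ s x = 0) →
  ∀ (N : ℕ) (Φ : Flow σ N) (z : Phase N), Regular σ r τ c η₁ Φ z →
    T₁ σ r τ φ Φ z + T₂ σ r τ φ Φ z + T₃ σ r τ φ Φ z ≤ entropyFunctional σ r τ φ Φ z + bdry σ r (φ 0) Φ z := by
  intro η₀ F hE η₁ c σ r τ hη₁ hc hσ hr hτ φ hφ hφ0 hsupp N Φ z hR
  by_cases hη : 0 < η₁
  · exact L.ledger_of_regular hE hη hη₁ hσ hr hc hτ hφ hφ0 hsupp Φ hR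
  · exfalso
    obtain ⟨h1, h2, -⟩ := hR.2 0 ⟨le_rfl, hτ.le⟩ (Classical.arbitrary T3)
    have : 0 < rhoC r (Φ.flow 0 z) (Classical.arbitrary T3) * σ ^ 3 := mul_pos (hc.trans_le h1) (pow_pos hσ 3)
    linarith

end Summit.AtomisticToContinuum.HydrodynamicLimit.Theorems.LocalSecondLawLedger

end
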